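import Summits.CriticalPhenomena.CardyFormulaZ2.Theses.CardyComplexCone
import Literature.Probability.LatticeModels.UnitDiscDiscretisation
import Literature.Probability.LatticeModels.MedialInterfaceProofs
import Literature.Probability.LatticeModels.MedialWindingBridge

/-!
# `EdgeCoherence` (route `CardyComplexCone`, stmt-CriticalPhenomena-11385): rigid values of the
# corner observable at the discrete marked point

Negative-side support for the crux `EdgeCoherence` (cdisprove unit, refuter
`refuter-cdisprove-stmt-CriticalPhenomena-11385-0`).  The crux asserts a UNIVERSAL class vector
`u` with which the four corner values `E_δ(v, f)` of the spin-`1/3` parafermionic edge observable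
are projectively aligned, `o(δ^{1/3})`-uniformly on compacts `K ⊆ D` of every Dobrushin domain and
every admissible discretisation family.  This file isolates the observable as a named function
`cornerObs` (the crux restated through it is `edgeCoherence_iff`, by `Iff.rfl`), expresses its
integrand through the corner ORBIT of `MedialInterfaceProofs` (`mem_dartFilter_iff`: passages of
the exploration path along the dart `(v, f)` = orbit hits before the exit), and computes the
RIGID values at the discrete marked point of the certified admissible family
`UnitDiscDiscretisation.discData` of the unit disc and of its arc-swapped twin `discDataSwap`:
the first dart is deterministic (`E_δ = 1` on the start class) and the two corner classes whose
faces leave the disc have `E_δ = 0`, for every mesh `0 < δ < 1/2` and every configuration.  The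
class vector at the marked point is therefore `(·, 0, 0, 1)` for `discData` (start class `−e₁`)
and `(0, 1, ·, 0)` for `discDataSwap` (start class `−e₀`) — not projectively universal.  The
companion file `FalseWithoutInterior.lean` turns this into `¬` of the crux with the hypothesis
`K ⊆ D.carrier` (resp. `IsCompact K`, resp. the mesh hypothesis) dropped.
-/

noncomputable section

open MeasureTheory Filter Topology
open Literature.Probability.LatticeModels Literature.Probability.RandomPlanarGeometry
open Literature.Probability.Percolation

namespace Summit.CriticalPhenomena.CardyFormulaZ2.Theorems.EdgeCoherence.Negative

open Summit.CriticalPhenomena.CardyFormulaZ2.Theses.CardyComplexCone (EdgeCoherence)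

/-! ## §0 The corner observable and the restated crux -/

/-- The spin-`1/3` corner (medial-edge) observable of the exploration path of the family `Λ` at
mesh `δ`: `E_δ(v,f) = E[ Σ_{passages of γ along the dart (v,f)} exp(-(i/3)·W) ]`, `W` the total
turning of the polyline prefix ending with that dart — VERBATIM the `let E := …` of the crux. [folklore] -/
def cornerObs (Λ : ℝ → DiscreteDobrushin) (δ : ℝ) (v f : Site 2) : ℂ :=
  ∫ ω, (let γ := medialExploration (Λ δ) ω
    ∑ k ∈ (Finset.range γ.length).filter
        (fun k => γ[k]? = some (cornerSource v f) ∧ γ[k + 1]? = some (cornerTarget v f)),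
      Complex.exp (-(Complex.I / 3) *
        ((Polyline.winding ((γ.map (medialPoint δ)).take (k + 2)) : ℝ) : ℂ)))
    ∂(bondPercolation (zdGraph 2) half)

/-- `u` is coherent on the family `Λ` over the set `K`: the crux's conclusion for one `(D, Λ, K)`. [folklore] -/
def CoherentOn (u : Site 2 → ℂ) (Λ : ℝ → DiscreteDobrushin) (K : Set ℂ) : Prop :=
  ∀ ε > (0:ℝ), ∀ᶠ δ in 𝓝[>] (0:ℝ), ∀ v f f' : Site 2, IsCorner v f → IsCorner v f' →
    meshPoint δ v ∈ K →
      ‖u (f' - v) * cornerObs Λ δ v f - u (f - v) * cornerObs Λ δ v f'‖ ≤ ε * δ ^ ((1:ℝ) / 3)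

/-- **The crux, restated** through `cornerObs` / `CoherentOn` — definitionally equal. [folklore] -/
theorem edgeCoherence_iff :
    EdgeCoherence ↔
      ∃ u : Site 2 → ℂ, (∃ o : Site 2, IsCorner 0 o ∧ u o ≠ 0) ∧
        ∀ (D : DobrushinDomain) (Λ : ℝ → DiscreteDobrushin), (∀ δ, (Λ δ).Ω = D.carrier) →
          (∀ δ, (Λ δ).δ = δ) → (∀ᶠ δ in 𝓝[>] (0:ℝ), (Λ δ).IsZdAdmissible) →
            ∀ K : Set ℂ, IsCompact K → K ⊆ D.carrier → CoherentOn u Λ K := by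
  -- no longer `Iff.rfl`: the route's `EdgeCoherence` spells FermionicObservable's `LatticeModels.winding`,
  -- `cornerObs` spells `Polyline.winding` (equal by `Polyline.winding_eq_winding'`, not definitionally)
  simp only [CoherentOn, cornerObs, Literature.Probability.LatticeModels.Polyline.winding_eq_winding']
  exact Iff.rfl

/-! ## §3a The integrand along the exploration orbit (any admissible data) -/

/-- The integrand of `cornerObs`: the phase sum of the path `γ` at the corner `(v, f)`. [folklore] -/
def dartPhaseSum (γ : List MedialVertex) (δ : ℝ) (v f : Site 2) : ℂ :=
  ∑ k ∈ (Finset.range γ.length).filter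
      (fun k => γ[k]? = some (cornerSource v f) ∧ γ[k + 1]? = some (cornerTarget v f)),
    Complex.exp (-(Complex.I / 3) *
      ((Polyline.winding ((γ.map (medialPoint δ)).take (k + 2)) : ℝ) : ℂ))

/-- `cornerObs` is the integral of `dartPhaseSum`. [folklore] -/
theorem cornerObs_eq (Λ : ℝ → DiscreteDobrushin) (δ : ℝ) (v f : Site 2) :
    cornerObs Λ δ v f =
      ∫ ω, dartPhaseSum (medialExploration (Λ δ) ω) δ v f ∂(bondPercolation (zdGraph 2) half) :=
  rfl

/-- A polyline with at most two points does not turn. [folklore] -/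
theorem winding_eq_zero_of_length_le_two {l : List ℂ} (h : l.length ≤ 2) : Polyline.winding l = 0 := by
  match l, h with
  | [], _ => rfl
  | [_], _ => rfl
  | [_, _], _ => rfl
  | _ :: _ :: _ :: _, h => simp at h

section Orbit

variable {D : DiscreteDobrushin} (hD : D.IsZdAdmissible) {c₀ : Site 2 × Fin 4}
  (hc₀ : D.IsStartCorner c₀)
include hD hc₀

/-- **Passages = orbit hits.** The dart `(p.1, cFace p)` is traversed at position `k` of the
exploration path iff `k` is before the last position and the `k`-th orbit corner is `p`. [folklore] -/
theorem mem_dartFilter_iff (ω : BondConfig (Site 2)) (p : Site 2 × Fin 4) (k : ℕ) :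
    k ∈ (Finset.range (medialExploration D ω).length).filter
        (fun k => (medialExploration D ω)[k]? = some (cornerSource p.1 (cFace p)) ∧
          (medialExploration D ω)[k + 1]? = some (cornerTarget p.1 (cFace p))) ↔
      k + 1 < (medialExploration D ω).length ∧ cornerOrbit (D.bcBondConfig ω) c₀ k = p := by
  have hγ := isMedialExploration_medialExploration_holds D hD ω
  set γ := medialExploration D ω with hγdef
  rw [Finset.mem_filter, Finset.mem_range, cornerSource_cFace, cornerTarget_cFace]
  constructor
  · rintro ⟨-, hs, ht⟩
    obtain ⟨hk1, ht'⟩ := List.getElem?_eq_some_iff.1 ht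
    have hk0 : k < γ.length := by omega
    obtain ⟨hk0', hs'⟩ := List.getElem?_eq_some_iff.1 hs
    obtain ⟨-, hsrc, htgt⟩ := hγ.dart_eq hD hc₀ k hk1
    refine ⟨hk1, eq_of_cSrc_eq_of_cTgt_eq ?_ ?_⟩
    · rw [hsrc, hs']
    · rw [htgt, ht']
  · rintro ⟨hk1, rfl⟩
    obtain ⟨-, hsrc, htgt⟩ := hγ.dart_eq hD hc₀ k hk1
    refine ⟨by omega, ?_, ?_⟩
    · rw [List.getElem?_eq_some_iff]; exact ⟨by omega, hsrc.symm⟩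
    · rw [List.getElem?_eq_some_iff]; exact ⟨hk1, htgt.symm⟩

/-- A corner missed by the orbit (before the exit) contributes nothing. [folklore] -/
theorem dartPhaseSum_eq_zero_of_forall_ne (ω : BondConfig (Site 2)) (δ : ℝ) (p : Site 2 × Fin 4)
    (h : ∀ k, k + 1 < (medialExploration D ω).length → cornerOrbit (D.bcBondConfig ω) c₀ k ≠ p) :
    dartPhaseSum (medialExploration D ω) δ p.1 (cFace p) = 0 := by
  refine Finset.sum_eq_zero fun k hk => ?_
  obtain ⟨hk1, hk2⟩ := (mem_dartFilter_iff hD hc₀ ω p k).1 hk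
  exact absurd hk2 (h k hk1)

/-- **Corners with non-inner face are never traversed**: `dartPhaseSum = 0` for every `ω`. [folklore] -/
theorem dartPhaseSum_eq_zero_of_not_isInnerFace (ω : BondConfig (Site 2)) (δ : ℝ)
    (p : Site 2 × Fin 4) (hp : ¬ D.IsInnerFace (cFace p)) :
    dartPhaseSum (medialExploration D ω) δ p.1 (cFace p) = 0 := by
  refine dartPhaseSum_eq_zero_of_forall_ne hD hc₀ ω δ p fun k hk h => hp ?_
  rw [← h]
  exact ((isMedialExploration_medialExploration_holds D hD ω).dart_eq hD hc₀ k hk).1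

/-- A corner hit by the orbit at position `k₀` (before the exit) contributes exactly the phase of
that passage (darts are not repeated). [folklore] -/
theorem dartPhaseSum_eq_of_orbit_eq (ω : BondConfig (Site 2)) (δ : ℝ) (p : Site 2 × Fin 4) (k₀ : ℕ)
    (hk₀ : k₀ + 1 < (medialExploration D ω).length) (horb : cornerOrbit (D.bcBondConfig ω) c₀ k₀ = p) :
    dartPhaseSum (medialExploration D ω) δ p.1 (cFace p) =
      Complex.exp (-(Complex.I / 3) *
        ((Polyline.winding (((medialExploration D ω).map (medialPoint δ)).take (k₀ + 2)) : ℝ) : ℂ)) := by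
  have hγ := isMedialExploration_medialExploration_holds D hD ω
  have hset : (Finset.range (medialExploration D ω).length).filter
      (fun k => (medialExploration D ω)[k]? = some (cornerSource p.1 (cFace p)) ∧
        (medialExploration D ω)[k + 1]? = some (cornerTarget p.1 (cFace p))) = {k₀} := by
    ext k
    rw [mem_dartFilter_iff hD hc₀ ω p k, Finset.mem_singleton]
    constructor
    · rintro ⟨hk1, hk⟩
      by_contra hne
      have hinner : ∀ j < max k k₀, D.IsInnerFace (cFace (cornerOrbit (D.bcBondConfig ω) c₀ j)) :=
        fun j hj => (hγ.dart_eq hD hc₀ j (by omega)).1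
      rcases lt_or_gt_of_ne hne with hlt | hlt
      · exact cornerOrbit_ne hD hc₀ hlt (fun j hj => hinner j (by omega)) (hk.trans horb.symm)
      · exact cornerOrbit_ne hD hc₀ hlt (fun j hj => hinner j (by omega)) (horb.trans hk.symm)
    · rintro rfl; exact ⟨hk₀, horb⟩
  unfold dartPhaseSum
  rw [hset, Finset.sum_singleton]

/-- **The first dart is deterministic**: the start corner is traversed at position `0` with phase
`1`, for every configuration. [folklore] -/
theorem dartPhaseSum_start (ω : BondConfig (Site 2)) (δ : ℝ) :
    dartPhaseSum (medialExploration D ω) δ c₀.1 (cFace c₀) = 1 := by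
  have hγ := isMedialExploration_medialExploration_holds D hD ω
  rw [dartPhaseSum_eq_of_orbit_eq hD hc₀ ω δ c₀ 0 (by simpa using hγ.one_lt_length) rfl,
    winding_eq_zero_of_length_le_two (by simp)]
  simp

end Orbit

/-! ## §3b The certified disc family: rigid values at the discrete marked point -/

section Disc

open UnitDiscDiscretisation

variable {δ : ℝ} (hδ : 0 < δ) (hδ' : δ < 1 / 2)
include hδ hδ'

/-- The start vertex `v_A = (-M, 0)` (`M = abCol δ`) of the exploration of `discData δ`. [folklore] -/
theorem isStartCorner_discData :
    (discData δ).IsStartCorner ((![-(abCol δ : ℤ), 0] : Site 2), (3 : Fin 4)) where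
  mem_zdArcA := xL0_mem_zdArcA hδ hδ'
  mem_zdArcB := by
    have : (![-(abCol δ : ℤ), 0] : Site 2) + cornerUnit 3 = ![-(abCol δ : ℤ), -1] := by
      funext i; fin_cases i <;> simp [cornerUnit]
    rw [this]; exact xL1_mem_zdArcB hδ hδ'
  isOutEdge := by
    constructor
    · have : faceAt (![-(abCol δ : ℤ), 0] : Site 2) 3 = ![-(abCol δ : ℤ), -1] := by
        funext i; fin_cases i <;> simp [faceAt, cornerOff]
      rw [this]; exact isInnerFace_fL hδ hδ'
    · have : faceAt (![-(abCol δ : ℤ), 0] : Site 2) (3 + 3) = ![-(abCol δ : ℤ) - 1, -1] := by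
        have h33 : (3 : Fin 4) + 3 = 2 := by decide
        rw [h33]; funext i; fin_cases i <;> simp [faceAt, cornerOff]
      rw [this]; exact not_isInnerFace_gL hδ hδ'

/-- The face `(-M-1, 0)` west of `v_A` is not inner (its corner `(-M-1, 1)` is outside). [folklore] -/
theorem not_isInnerFace_west : ¬ (discData δ).IsInnerFace ![-(abCol δ : ℤ) - 1, 0] := by
  refine not_isInnerFace_of (v := ![-(abCol δ : ℤ) - 1, 0]) (w := ![-(abCol δ : ℤ) - 1, 1])
    ?_ ?_ ?_ ?_
  · intro i; fin_cases i <;> simp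
  · intro i; fin_cases i <;> simp
  · exact adj_of_eq_add_single_one fun i => by fin_cases i <;> simp
  · refine not_norm_lt_one_of hδ hδ' ?_ ?_
    · have : (0 : ℤ) ≤ abCol δ := Int.natCast_nonneg _
      simp only [Matrix.cons_val_zero]
      rw [abs_of_nonpos (by linarith)]; ring
    · simp

/-- **Rigid value 1**: the class-`(−e₁)` corner at `v_A` (the first dart) has `E_δ = 1`. [folklore] -/
theorem cornerObs_discData_start :
    cornerObs discData δ ![-(abCol δ : ℤ), 0] (faceAt ![-(abCol δ : ℤ), 0] 3) = 1 := by
  rw [cornerObs_eq]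
  have : (fun ω => dartPhaseSum (medialExploration (discData δ) ω) δ ![-(abCol δ : ℤ), 0]
      (faceAt ![-(abCol δ : ℤ), 0] 3)) = fun _ => (1 : ℂ) := by
    funext ω
    exact dartPhaseSum_start (isZdAdmissible_discData hδ hδ') (isStartCorner_discData hδ hδ') ω δ
  rw [this, integral_const]
  simp

/-- **Rigid value 0**: the class-`(−e₀)` corner at `v_A` (face west of the domain) has `E_δ = 0`. [folklore] -/
theorem cornerObs_discData_vA_one :
    cornerObs discData δ ![-(abCol δ : ℤ), 0] (faceAt ![-(abCol δ : ℤ), 0] 1) = 0 := by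
  rw [cornerObs_eq]
  have : (fun ω => dartPhaseSum (medialExploration (discData δ) ω) δ ![-(abCol δ : ℤ), 0]
      (faceAt ![-(abCol δ : ℤ), 0] 1)) = fun _ => (0 : ℂ) := by
    funext ω
    refine dartPhaseSum_eq_zero_of_not_isInnerFace (isZdAdmissible_discData hδ hδ')
      (isStartCorner_discData hδ hδ') ω δ (![-(abCol δ : ℤ), 0], 1) ?_
    have : cFace ((![-(abCol δ : ℤ), 0] : Site 2), (1 : Fin 4)) = ![-(abCol δ : ℤ) - 1, 0] := by
      funext i; fin_cases i <;> simp [cFace, faceAt, cornerOff]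
    rw [this]; exact not_isInnerFace_west hδ hδ'
  rw [this, integral_zero]

/-- **Rigid value 0**: the class-`(−e₀−e₁)` corner at `v_A` (face south-west) has `E_δ = 0`. [folklore] -/
theorem cornerObs_discData_vA_two :
    cornerObs discData δ ![-(abCol δ : ℤ), 0] (faceAt ![-(abCol δ : ℤ), 0] 2) = 0 := by
  rw [cornerObs_eq]
  have : (fun ω => dartPhaseSum (medialExploration (discData δ) ω) δ ![-(abCol δ : ℤ), 0]
      (faceAt ![-(abCol δ : ℤ), 0] 2)) = fun _ => (0 : ℂ) := by
    funext ω
    refine dartPhaseSum_eq_zero_of_not_isInnerFace (isZdAdmissible_discData hδ hδ')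
      (isStartCorner_discData hδ hδ') ω δ (![-(abCol δ : ℤ), 0], 2) ?_
    have : cFace ((![-(abCol δ : ℤ), 0] : Site 2), (2 : Fin 4)) = ![-(abCol δ : ℤ) - 1, -1] := by
      funext i; fin_cases i <;> simp [cFace, faceAt, cornerOff]
    rw [this]; exact not_isInnerFace_gL hδ hδ'
  rw [this, integral_zero]

/-- The start vertex lies in the open unit disc. [folklore] -/
theorem norm_meshPoint_vA_lt_one : ‖meshPoint δ ![-(abCol δ : ℤ), 0]‖ < 1 :=
  norm_lt_one_of_abs_le hδ hδ' (by simp [abs_of_nonneg (Int.natCast_nonneg (abCol δ))]) (by simp)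

end Disc

/-! ## §3d The arc-swapped disc family: the exploration starts at the right edge with class `−e₀` -/

section Swap

open UnitDiscDiscretisation

/-- The certified disc data with the two arcs EXCHANGED (`A` = tilted lower arc, `B` = tilted upper
arc): same discrete domain, same `A`–`B` edges, admissible by symmetry of `IsZdAdmissible` in the
two arcs; its exploration runs from the right marked point to the left one. [folklore] -/
def discDataSwap (δ : ℝ) : DiscreteDobrushin := ⟨Metric.ball (0 : ℂ) 1, δ, tiltLo δ, tiltUp δ⟩

/-- The domain of the swapped data is the unit disc. [folklore] -/
@[simp] theorem discDataSwap_Ω (δ : ℝ) : (discDataSwap δ).Ω = Metric.ball (0 : ℂ) 1 := rfl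
/-- The mesh of the swapped data. [folklore] -/
@[simp] theorem discDataSwap_δ (δ : ℝ) : (discDataSwap δ).δ = δ := rfl

/-- The discrete arc `A` of the swapped data is the arc `B` of `discData`. [folklore] -/
theorem zdArcA_swap (δ : ℝ) : (discDataSwap δ).zdArcA = (discData δ).zdArcB := rfl
/-- The discrete arc `B` of the swapped data is the arc `A` of `discData`. [folklore] -/
theorem zdArcB_swap (δ : ℝ) : (discDataSwap δ).zdArcB = (discData δ).zdArcA := rfl
/-- Inner faces do not depend on the arcs. [folklore] -/
theorem isInnerFace_swap (δ : ℝ) (f : Site 2) :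
    (discDataSwap δ).IsInnerFace f ↔ (discData δ).IsInnerFace f := Iff.rfl
/-- The discrete boundary does not depend on the arcs. [folklore] -/
theorem zdBoundary_swap (δ : ℝ) : (discDataSwap δ).zdBoundary = (discData δ).zdBoundary := rfl

/-- The `A`–`B` edges are symmetric in the two arcs. [folklore] -/
theorem zdABEdges_swap (δ : ℝ) : (discDataSwap δ).zdABEdges = (discData δ).zdABEdges := by
  ext e
  simp only [DiscreteDobrushin.mem_zdABEdges_iff, zdArcA_swap, zdArcB_swap, discDataSwap_Ω,
    discDataSwap_δ, discData_Ω, discData_δ]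
  tauto

variable {δ : ℝ} (hδ : 0 < δ) (hδ' : δ < 1 / 2)
include hδ hδ'

/-- The arc-swapped data are admissible (`0 < δ < 1/2`). [folklore] -/
theorem isZdAdmissible_discDataSwap : (discDataSwap δ).IsZdAdmissible := by
  have h := isZdAdmissible_discData hδ hδ'
  exact
    { isBounded := h.isBounded
      delta_pos := h.delta_pos
      zdArcA_nonempty := h.zdArcB_nonempty
      zdArcB_nonempty := h.zdArcA_nonempty
      disjoint := by rw [zdArcA_swap, zdArcB_swap]; exact h.disjoint.symm
      zdBoundary_subset := by
        rw [zdArcA_swap, zdArcB_swap, zdBoundary_swap, Set.union_comm]; exact h.zdBoundary_subset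
      ncard_zdABEdges_eq_two := by rw [zdABEdges_swap]; exact h.ncard_zdABEdges_eq_two
      zdABEdges_inner := by
        intro e he
        rw [zdABEdges_swap] at he
        exact h.zdABEdges_inner e he }

/-- The start corner of the swapped data: vertex `(M, 0)` (on the new arc `A`), class `−e₀`
(face `(M-1, 0)` inner, face `(M, 0)` not). [folklore] -/
theorem isStartCorner_discDataSwap :
    (discDataSwap δ).IsStartCorner ((![(abCol δ : ℤ), 0] : Site 2), (1 : Fin 4)) where
  mem_zdArcA := by rw [zdArcA_swap]; exact xR0_mem_zdArcB hδ hδ'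
  mem_zdArcB := by
    have : (![(abCol δ : ℤ), 0] : Site 2) + cornerUnit 1 = ![(abCol δ : ℤ), 1] := by
      funext i; fin_cases i <;> simp [cornerUnit]
    rw [zdArcB_swap, this]; exact xR1_mem_zdArcA hδ hδ'
  isOutEdge := by
    constructor
    · have : faceAt (![(abCol δ : ℤ), 0] : Site 2) 1 = ![(abCol δ : ℤ) - 1, 0] := by
        funext i; fin_cases i <;> simp [faceAt, cornerOff]
      rw [this]; exact (isInnerFace_swap δ _).2 (isInnerFace_fR hδ hδ')
    · have : faceAt (![(abCol δ : ℤ), 0] : Site 2) (1 + 3) = ![(abCol δ : ℤ), 0] := by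
        have h13 : (1 : Fin 4) + 3 = 0 := by decide
        rw [h13]; funext i; fin_cases i <;> simp [faceAt, cornerOff]
      rw [this]; exact fun h => not_isInnerFace_gR hδ hδ' ((isInnerFace_swap δ _).1 h)

/-- The face `(M, -1)` south-east of `(M, 0)` is not inner (its corner `(M+1, -1)` is outside). [folklore] -/
theorem not_isInnerFace_southEast : ¬ (discData δ).IsInnerFace ![(abCol δ : ℤ), -1] := by
  refine not_isInnerFace_of (v := ![(abCol δ : ℤ) + 1, 0]) (w := ![(abCol δ : ℤ) + 1, -1])
    ?_ ?_ ?_ ?_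
  · intro i; fin_cases i <;> simp
  · intro i; fin_cases i <;> simp
  · exact (adj_of_eq_add_single_one fun i => by fin_cases i <;> simp).symm
  · refine not_norm_lt_one_of hδ hδ' ?_ ?_
    · have : (0 : ℤ) ≤ abCol δ := Int.natCast_nonneg _
      simp only [Matrix.cons_val_zero]
      rw [abs_of_nonneg (by linarith)]
    · simp

/-- **Rigid value 1** (swapped data): the class-`(−e₀)` corner at `(M, 0)` has `E_δ = 1`. [folklore] -/
theorem cornerObs_discDataSwap_start :
    cornerObs discDataSwap δ ![(abCol δ : ℤ), 0] (faceAt ![(abCol δ : ℤ), 0] 1) = 1 := by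
  rw [cornerObs_eq]
  have : (fun ω => dartPhaseSum (medialExploration (discDataSwap δ) ω) δ ![(abCol δ : ℤ), 0]
      (faceAt ![(abCol δ : ℤ), 0] 1)) = fun _ => (1 : ℂ) := by
    funext ω
    exact dartPhaseSum_start (isZdAdmissible_discDataSwap hδ hδ') (isStartCorner_discDataSwap hδ hδ') ω δ
  rw [this, integral_const]
  simp

/-- **Rigid value 0** (swapped data): class `0` at `(M, 0)` (face `(M,0)` east, not inner). [folklore] -/
theorem cornerObs_discDataSwap_zero :
    cornerObs discDataSwap δ ![(abCol δ : ℤ), 0] (faceAt ![(abCol δ : ℤ), 0] 0) = 0 := by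
  rw [cornerObs_eq]
  have : (fun ω => dartPhaseSum (medialExploration (discDataSwap δ) ω) δ ![(abCol δ : ℤ), 0]
      (faceAt ![(abCol δ : ℤ), 0] 0)) = fun _ => (0 : ℂ) := by
    funext ω
    refine dartPhaseSum_eq_zero_of_not_isInnerFace (isZdAdmissible_discDataSwap hδ hδ')
      (isStartCorner_discDataSwap hδ hδ') ω δ (![(abCol δ : ℤ), 0], 0) ?_
    have : cFace ((![(abCol δ : ℤ), 0] : Site 2), (0 : Fin 4)) = ![(abCol δ : ℤ), 0] := by
      funext i; fin_cases i <;> simp [cFace, faceAt, cornerOff]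
    rw [this]; exact fun h => not_isInnerFace_gR hδ hδ' ((isInnerFace_swap δ _).1 h)
  rw [this, integral_zero]

/-- **Rigid value 0** (swapped data): class `−e₁` at `(M, 0)` (face `(M,-1)` south-east, not inner). [folklore] -/
theorem cornerObs_discDataSwap_three :
    cornerObs discDataSwap δ ![(abCol δ : ℤ), 0] (faceAt ![(abCol δ : ℤ), 0] 3) = 0 := by
  rw [cornerObs_eq]
  have : (fun ω => dartPhaseSum (medialExploration (discDataSwap δ) ω) δ ![(abCol δ : ℤ), 0]
      (faceAt ![(abCol δ : ℤ), 0] 3)) = fun _ => (0 : ℂ) := by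
    funext ω
    refine dartPhaseSum_eq_zero_of_not_isInnerFace (isZdAdmissible_discDataSwap hδ hδ')
      (isStartCorner_discDataSwap hδ hδ') ω δ (![(abCol δ : ℤ), 0], 3) ?_
    have : cFace ((![(abCol δ : ℤ), 0] : Site 2), (3 : Fin 4)) = ![(abCol δ : ℤ), -1] := by
      funext i; fin_cases i <;> simp [cFace, faceAt, cornerOff]
    rw [this]; exact fun h => not_isInnerFace_southEast hδ hδ' ((isInnerFace_swap δ _).1 h)
  rw [this, integral_zero]

/-- The start vertex `(M, 0)` of the swapped data lies in the open unit disc. [folklore] -/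
theorem norm_meshPoint_xR0_lt_one : ‖meshPoint δ ![(abCol δ : ℤ), 0]‖ < 1 :=
  norm_lt_one_of_abs_le hδ hδ' (by simp [abs_of_nonneg (Int.natCast_nonneg (abCol δ))]) (by simp)

end Swap


end Summit.CriticalPhenomena.CardyFormulaZ2.Theorems.EdgeCoherence.Negative

end
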